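import Literature.MathematicalPhysics.QuantumFieldTheory.Balaban1983to89.B5G183KernelSplit
import Literature.MathematicalPhysics.QuantumFieldTheory.Balaban1983to89.B5G183FreeDecay
import Literature.MathematicalPhysics.QuantumFieldTheory.Balaban1983to89.B5Kernel166Decay

/-!
# `Balaban1983to89.B5G183KernelDecay` — the kernel of `G = Δ_1⁻¹` on block points: its covariant part IS
`n^{−(d+1)}`× the coarse-torus kernel of `Mcov` and DECAYS EXPONENTIALLY, uniformly in `n` and in the torus;
its free part IS the fine-torus kernel of `freeMult`

T. Bałaban, *Propagators and renormalization transformations for lattice gauge theories. I*, Commun. Math.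
Phys. **95**, 17–40 (1984) [`Balaban1984PropagatorsI`, cell paper B5].  What the paper PRINTS (verbatim; renders
`b2b-balaban-ref1/pages/1984-cmp95-propagators-rt-I/…-p015-x2.png` (journal p. 31), `…-p019-x2.png` (p. 35),
`…-p020-x2.png` (p. 36) read as images by this seat):
* p. 31 [PDF 15]: «This gives the solution of Eq. (1.73), so G = Δ_a⁻¹. To investigate better the operator G we write
  it in momentum representation:» — formula (1.83);
* p. 35 [PDF 19], Proposition 1.2, first display: «There exists a positive constant δ₀ depending on d only, such that
  |(GJ)(x)|, |(∇GJ)(x)|, |(G∇*J)(x)|, |(ΔGJ)(x)| ≤ O(1)e^{−δ₀|y−y′|}|J|  (1.110)  for x ∈ Δ̃(y), supp J ⊂ Δ̃(y′), with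
  the constant O(1) depending on d only,»;
* p. 36 [PDF 20], ll. 20–23 (the printed remark on the road NOT taken in print): «Probably the simplest proof of the
  exponential decay properties can be obtained by relating G on the torus to G on the whole lattice ηZ^d in the usual
  way, and then proving that the operator e^{−⟨q,x⟩}Δ_a e^{⟨q,x⟩} − Δ_a is a small perturbation of Δ_a for vectors
  q ∈ R^d sufficiently small.»

CITATION HEADER (lean-in-tree rule).  This module is a SUPPLEMENT, not a quotation: it is the kernel-level,
`a = 1`, `U = 1` companion of the FIRST entry of (1.110) obtained along the remark of p. 36 (strip analyticity of the
(1.83) symbol ⇒ exponential decay of Fourier kernels ⇒ periodisation onto the torus), i.e. along the pv15 chain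
`B5G183Strip → B5G183Alias → B5G183AliasSum → B5G183CovSplit → B5G183CovDecay / B5G183FreeDecay → B5G183Kernel →
B5G183KernelSplit`.  The printed proof of Prop. 1.2 (pp. 36–39, random-walk expansion) is NOT followed and no printed
constant (`δ₀`, `O(1)`) is compared with ours.  Every declaration is `[folklore]` audit mathematics; `[cite: …]` tags
mark the location of printed TEXT only.  ABSOLUTE RULE honoured: no statement of the papers is used as a hypothesis;
the only imports are kernel-proved tree modules.

CONTENT (dimension `d + 1 ≥ 1`, `a = 1`, `U = 1`, every `n ≥ 1`, every multi-period `M` (all `M_i ≥ 1`), every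
truncation order `N` with `N + 1 ≥ d + 1` where the covariant multiplier needs it).
§1 COVARIANT PART.  `Mcov_grid_eq`: the two momentum conventions on the coarse grid (`2π·rep(t_i/M_i) ∈ [−π,π)` of the
   torus-kernel engine `B4TorusKernel.MultiPeriod` versus `p′ = sOf ∈ (−π,π]` of (1.29)) give the same value of
   `B5G183CovDecay.Mcov` (`B4TorusKernel.face_match` with `stripRegular_Mcov`);  `covSum_toT_eq_torusKernel`:
   `|T₁|^{−1} Σ_{q∈T̃₁} e^{ip′_q·x} Mcov(p′_q) = MultiPeriod.torusKernel (descendC Mcov) M x`;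
   **`DeltaA_one_inv_bpt_eq`**: `(Δ_1⁻¹)_{(n x̄+r,μ),(n x̄′+r′,ν)} = [Σ_{j<N}((Lap+1)⁻¹)^{j+1}]_{(n x̄+r,μ),(n x̄′+r′,ν)}
   + n^{−(d+1)} · torusKernel (descendC (Mcov n N μ ν r r′)) M (x − x′)`;
   **`norm_DeltaA_one_inv_bpt_sub_free_le`** (the DECAY, `B5G183CovDecay.torusKernel_Mcov_decay` BY NAME):
   `‖(Δ_1⁻¹)_{(n x̄+r,μ),(n x̄′+r′,ν)} − [free]_{…}‖ ≤ n^{−(d+1)} · MD183(d+1,N) · periodConst(κ₁₈₃(d+1), d) ·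
   e^{−(κ₁₈₃(d+1)/(d+1)) · |x − x′|_{T₁,∞}}` — constants depending on `d` and `N` only: free of `n = L^k` and of the
   torus (`…_le'`: the same for arbitrary coarse classes `y, y′` through the canonical representatives
   `B6LowerBound2153Torus.rep`).
§2 FREE PART.  `LapSym_eq_fineSym`: the symbol of the typed fine vector Laplacian `B5Prop11Lower.LapSym` at a fine
   momentum class `p` IS `B5G183FreeDecay.fineSym n` at `sOf (fine n M) p` (`= n²Σ_μ(2 − 2cos)`, any dimension);
   `resolv_LapSym_grid_eq`; **`freePart_toT_eq_torusKernel`**: `[Σ_{j<N}((Lap+1)⁻¹)^{j+1}]_{(m̄,μ),(m̄′,ν)} = δ_{μν} ·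
   MultiPeriod.torusKernel (descendC (freeMult n N)) (fine n M) (m − m′)` on fine representatives `m, m′ ∈ ℤ^{d+1}`;
   `norm_freePart_le` (`B5G183FreeDecay.torusKernel_freeMult_decay` BY NAME — see HONEST SCOPE (iii)).
§3 ASSEMBLY.  `bpt_toT`: the block point `n·x̄ + r` is the class of the fine representative `n·x + r`;
   **`norm_DeltaA_one_inv_bpt_le`**: `‖(Δ_1⁻¹)_{(n x̄+r,μ),(n x̄′+r′,ν)}‖ ≤ MF(N)·periodConst(r(d+1)/n, d)·
   e^{−((r(d+1)/n)/(d+1))·|n(x−x′)+r−r′|_{T_η,∞}} + n^{−(d+1)}·MD183·periodConst(κ₁₈₃)·e^{−(κ₁₈₃/(d+1))|x−x′|_{T₁,∞}}`.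

HONEST SCOPE.  (i) ENTRIES of the kernel between block points `n·ȳ + r` (every point of `T_η` is one,
`B5Blocks16.bpt_bijective`), NOT the operator form `|(GJ)(x)| ≤ O(1)e^{−δ₀|y−y′|}|J|` of (1.110): the block sum
`Σ_{x′∈B(y′)}` of the covariant majorant (`n^{d+1}` points × `n^{−(d+1)}`) is the consumer's one-line bookkeeping; for
the free part it needs (iii).  (ii) `a = 1` (convention of `B5G183Strip`), `U = 1`, finite torus, `η = 1/n`, mass `1`
in coarse units; the `η^{d+1}`-normalisation dictionary of (1.29) is that of `B5DeltaA169` (matrix entries of the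
inverse matrix), not re-derived.  (iii) The FREE torus majorant of §2–§3 is TRUE AS TYPED but its constant
`MF N · periodConst (r(d+1)/n) d` is NOT uniform in `n` (it grows like `(2n/r(d+1))^{d+1}`, `B5G183FreeDecay` HONEST
SCOPE (v)); the `n`-UNIFORM statement of this leaf is the covariant one (§1) and the `ℤ^{d+1}` free bound
`B5G183FreeDecay.latticeKernel_freeMult_decay`; an `n`-uniform periodisation of the free kernel in COARSE units is the
next node of this lineage, not done here.  (iv) Rates/constants crude and ours (`κ₁₈₃(d+1)/(d+1)` per coarse unit,
`MD183`, `periodConst`); nothing printed is matched.  (v) No `def` is introduced; every object is an existing tree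
declaration used BY NAME.  NEAREST TREE NEIGHBOUR (searched `Beta/DeltaACombesThomas`, `Beta/CombesThomas*`,
`Beta/TorusG0*`, `B5Decay126`, `B5Hk163Torus`): `Beta/DeltaACombesThomas.calG_form_decay_of_pieces` bounds
`|⟨u, Δ_a⁻¹v⟩|` for general `a` by Combes–Thomas CONDITIONALLY on a row-defect form of (1.126) (`hP`); the present
leaf is unconditional, `a = 1`, entrywise, by strip analyticity — neither statement implies the other.  Value = kernel
certificate (the typed decay of the covariant part of Bałaban's `G` itself), NOT summit progress.  Unit
`b2b-balaban-pv15-g12` (PV15 cell lineage, generation 12).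
-/

open scoped BigOperators Matrix ComplexConjugate Real
open Finset Complex Matrix

namespace Literature.MathematicalPhysics.QuantumFieldTheory.Balaban1983to89.B5G183KernelDecay

open Literature.MathematicalPhysics.QuantumFieldTheory.Balaban1983to89.B4Strip (ofRealVec)
open Literature.MathematicalPhysics.QuantumFieldTheory.Balaban1983to89.B4StripCauchy (rOf rOf_pos)
open Literature.MathematicalPhysics.QuantumFieldTheory.Balaban1983to89.B4ContourShift (BZ StripRegular)
open Literature.MathematicalPhysics.QuantumFieldTheory.Balaban1983to89.B4TorusKernel (descendC descendC_apply
  face_match rep_mem periodConst)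
open Literature.MathematicalPhysics.QuantumFieldTheory.Balaban1983to89.B4TorusKernel.MultiPeriod (gridPt torusSum
  torusKernel torusSupNorm torusSupNorm_nonneg torusKernel_descend_decay_torusMetric)
open Literature.MathematicalPhysics.QuantumFieldTheory.Balaban1983to89.B5Prop11Plancherel (Tor chi dftV fine sOf fsym
  conj_chi chi_add_right chi_neg_neg abs_sOf_le)
open Literature.MathematicalPhysics.QuantumFieldTheory.Balaban1983to89.B5Prop11Lower (Lap LapSym)
open Literature.MathematicalPhysics.QuantumFieldTheory.Balaban1983to89.B5Block118 (bpt up iota upHom_intCast)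
open Literature.MathematicalPhysics.QuantumFieldTheory.Balaban1983to89.B5DeltaA169 (DeltaA)
open Literature.MathematicalPhysics.QuantumFieldTheory.Balaban1983to89.B5G183Strip (kappa183 kappa183_pos)
open Literature.MathematicalPhysics.QuantumFieldTheory.Balaban1983to89.B5G183CovSplit (resolv)
open Literature.MathematicalPhysics.QuantumFieldTheory.Balaban1983to89.B5G183CovDecay (Mcov stripRegular_Mcov
  torusKernel_Mcov_decay MD183 MD183_nonneg)
open Literature.MathematicalPhysics.QuantumFieldTheory.Balaban1983to89.B5G183FreeDecay (fineSym fineSym_eq freeMult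
  stripRegular_freeMult rOf_div_pos rOf_div_admissible MF MF_nonneg torusKernel_freeMult_decay)
open Literature.MathematicalPhysics.QuantumFieldTheory.Balaban1983to89.B5G183KernelSplit (resolventPowers_apply
  DeltaA_one_inv_apply_bpt_split')
open Literature.MathematicalPhysics.QuantumFieldTheory.Balaban1983to89.B5Kernel166Decay (torFin card_Tor_cast toT_sub
  chi_toT_eq_mFourier two_pi_rep_grid periodConst_pos)
open Literature.MathematicalPhysics.QuantumFieldTheory.Balaban1983to89.B6LowerBound2153Torus (toT toT_rep)
open Literature.MathematicalPhysics.QuantumFieldTheory.Balaban1983to89.B6Cov2156Torus (one_le_M)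

noncomputable section

variable {d : ℕ}

/-! ## §0. Block points as classes of fine representatives (any dimension) -/

section Bookkeeping

variable (n : ℕ) [NeZero n] (M : Fin d → ℕ) [hM : ∀ μ, NeZero (M μ)]

omit [NeZero n] hM in
/-- **THE BLOCK POINT `n·x̄ + r` IS THE CLASS OF THE FINE REPRESENTATIVE `n·x + r`**:
`bpt (toT M x) r = toT (fine n M) (n·x + r)` ((1.6): `x = n·y + j`, `0 ≤ j_μ < n`). [cite: Balaban1984PropagatorsI, (1.6) p.18 (location of the blocks)] [folklore] -/
theorem bpt_toT (x : Fin d → ℤ) (r : Fin d → Fin n) :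
    bpt n M (toT M x) r = toT (fine n M) (fun i => (n : ℤ) * x i + ((r i : ℕ) : ℤ)) := by
  funext ν
  show up n M (toT M x) ν + iota n M r ν = (((n : ℤ) * x ν + ((r ν : ℕ) : ℤ) : ℤ) : ZMod (fine n M ν))
  simp only [up, iota, toT, upHom_intCast]
  push_cast
  ring

end Bookkeeping

/-! ## §1. The covariant part on block points = `n^{−(d+1)}` × the coarse-torus kernel of `Mcov`; its decay -/

section Cov

variable (n : ℕ) [NeZero n] (hn : 1 ≤ n) (M : Fin (d + 1) → ℕ) [hM : ∀ μ, NeZero (M μ)]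

/-- the two momentum conventions on the coarse grid (`2π rep(t_i/M_i) ∈ [−π,π)` of the engine versus
`p′ = sOf ∈ (−π,π]`) give the same value of the covariant fine-offset multiplier `Mcov` (the face flip is absorbed by
the `2π`-periodicity across the strip sides, `B4TorusKernel.face_match` + `B5G183CovDecay.stripRegular_Mcov`;
pattern `B5Hk163Torus.G163_grid_eq`). [folklore] -/
theorem Mcov_grid_eq {N : ℕ} (hN : d + 1 ≤ N + 1) (μ ν : Fin (d + 1)) (a b : Fin (d + 1) → Fin n)
    (t : Tor M) :
    Mcov n N μ ν a b
        (ofRealVec (fun i => 2 * Real.pi * B4TorusKernel.rep ((((torFin M t i : ℕ) : ℝ) / M i : ℝ) : UnitAddCircle)))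
      = Mcov n N μ ν a b (ofRealVec (sOf M t)) := by
  classical
  set u : Fin (d + 1) → ℝ :=
    fun i => 2 * Real.pi * B4TorusKernel.rep ((((torFin M t i : ℕ) : ℝ) / M i : ℝ) : UnitAddCircle) with hu_def
  have hdich : ∀ i, u i = sOf M t i ∨ (u i = -Real.pi ∧ sOf M t i = Real.pi) := fun i => two_pi_rep_grid M t i
  have hu : u ∈ BZ (d + 1) := by
    refine ⟨fun i => ?_, fun i => ?_⟩
    · have h := (rep_mem (((((torFin M t i : ℕ) : ℝ) / M i : ℝ) : UnitAddCircle))).1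
      show -Real.pi ≤ 2 * Real.pi * _
      nlinarith [Real.pi_pos]
    · have h := (rep_mem (((((torFin M t i : ℕ) : ℝ) / M i : ℝ) : UnitAddCircle))).2
      show 2 * Real.pi * _ ≤ Real.pi
      nlinarith [Real.pi_pos]
  have hv : sOf M t ∈ BZ (d + 1) :=
    ⟨fun i => (abs_le.mp (abs_sOf_le M t i)).1, fun i => (abs_le.mp (abs_sOf_le M t i)).2⟩
  refine face_match (stripRegular_Mcov n (kappa183_pos _).le le_rfl hN μ ν a b) (kappa183_pos _).le
    (Finset.univ.filter fun i => u i ≠ sOf M t i) u (sOf M t) hu hv (fun i hi => ?_) (fun i hi => ?_)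
  · by_contra h
    exact hi (Finset.mem_filter.mpr ⟨Finset.mem_univ _, h⟩)
  · have h := (Finset.mem_filter.mp hi).2
    rcases hdich i with h' | h'
    · exact absurd h' h
    · exact h'

/-- **THE COARSE-TORUS INVERSE DFT OF `Mcov` IS THE TORUS KERNEL OF ITS DESCENT**: at a lattice representative
`x ∈ ℤ^{d+1}`, `|T₁|^{−1} Σ_{q ∈ T̃₁} e^{ip′_q·x̄} Mcov(p′_q) = MultiPeriod.torusKernel (descendC Mcov) M x`
(`= Σ_m latticeKernel Mcov (x + Mm)`, the periodised `ℤ^{d+1}` kernel, by `MultiPeriod.torusKernel_descend_eq`).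
[cite: Balaban1984PropagatorsI, p.36 ll.20–23 (location of the remark «relating G on the torus to G on the whole lattice»)] [folklore] -/
theorem covSum_toT_eq_torusKernel {N : ℕ} (hN : d + 1 ≤ N + 1) (μ ν : Fin (d + 1))
    (a b : Fin (d + 1) → Fin n) (x : Fin (d + 1) → ℤ) :
    ((Fintype.card (Tor M) : ℂ))⁻¹ * ∑ q : Tor M, chi M q (toT M x) * Mcov n N μ ν a b (ofRealVec (sOf M q))
      = torusKernel (descendC (fun p : Fin (d + 1) → ℂ => Mcov n N μ ν a b p)
          (stripRegular_Mcov n (kappa183_pos _).le le_rfl hN μ ν a b) (kappa183_pos _).le) M x := by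
  unfold torusKernel torusSum
  rw [card_Tor_cast]
  congr 1
  refine Fintype.sum_equiv (torFin M) _ _ fun t => ?_
  rw [descendC_apply, B4TorusKernel.MultiPeriod.descend_gridPt, chi_toT_eq_mFourier, mul_comm]
  congr 1
  exact (Mcov_grid_eq n M hN μ ν a b t).symm

include hn in
/-- **`G = Δ_1⁻¹` ON BLOCK POINTS = FREE RESOLVENT POLYNOMIAL + `n^{−(d+1)}`× THE COARSE-TORUS KERNEL OF `Mcov`**:
for lattice representatives `x, x′ ∈ ℤ^{d+1}` of the coarse classes and fine offsets `r, r′`,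
`(Δ_1⁻¹)_{(n x̄+r,μ),(n x̄′+r′,ν)} = [Σ_{j<N}((Lap+1)⁻¹)^{j+1}]_{(n x̄+r,μ),(n x̄′+r′,ν)}
  + n^{−(d+1)} · torusKernel (descendC (Mcov n N μ ν r r′)) M (x − x′)`
(`B5G183KernelSplit.DeltaA_one_inv_apply_bpt_split'` + `covSum_toT_eq_torusKernel`).
[cite: Balaban1984PropagatorsI, p.31 «so G = Δ_a⁻¹ … momentum representation» (1.83) (location)] [folklore] -/
theorem DeltaA_one_inv_bpt_eq {N : ℕ} (hN : d + 1 ≤ N + 1) (x x' : Fin (d + 1) → ℤ)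
    (r r' : Fin (d + 1) → Fin n) (μ ν : Fin (d + 1)) :
    (DeltaA n M 1)⁻¹ (bpt n M (toT M x) r, μ) (bpt n M (toT M x') r', ν)
      = (∑ j ∈ Finset.range N, ((Lap n M + 1)⁻¹) ^ (j + 1)) (bpt n M (toT M x) r, μ) (bpt n M (toT M x') r', ν)
        + ((n : ℂ) ^ (d + 1))⁻¹ *
          torusKernel (descendC (fun p : Fin (d + 1) → ℂ => Mcov n N μ ν r r' p)
            (stripRegular_Mcov n (kappa183_pos _).le le_rfl hN μ ν r r') (kappa183_pos _).le) M (x - x') := by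
  rw [DeltaA_one_inv_apply_bpt_split' n hn M N, toT_sub, ← covSum_toT_eq_torusKernel n M hN μ ν r r' (x - x')]
  congr 1
  rw [Finset.mul_sum, Finset.mul_sum, Finset.mul_sum]
  exact Finset.sum_congr rfl fun q _ => by ring

include hn in
/-- **EXPONENTIAL DECAY OF THE COVARIANT PART OF THE KERNEL OF `G = Δ_1⁻¹`, UNIFORMLY IN `n = L^k` AND IN THE
TORUS**: for every `n ≥ 1`, multi-period `M`, `N ≥ d`, `μ ν r r′` and lattice representatives `x, x′`,
`‖(Δ_1⁻¹)_{(n x̄+r,μ),(n x̄′+r′,ν)} − [Σ_{j<N}((Lap+1)⁻¹)^{j+1}]_{(n x̄+r,μ),(n x̄′+r′,ν)}‖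
  ≤ n^{−(d+1)} · MD183(d+1,N) · periodConst(κ₁₈₃(d+1), d) · e^{−(κ₁₈₃(d+1)/(d+1)) · |x − x′|_{T₁,∞}}`
(`B5G183CovDecay.torusKernel_Mcov_decay` BY NAME; the constants depend on `d` and `N` only).
[cite: Balaban1984PropagatorsI, Prop. 1.2 (1.110) p.35 (location of the printed decay statement for `GJ`; kernel-level `a = 1` companion, constants ours)] [folklore] -/
theorem norm_DeltaA_one_inv_bpt_sub_free_le {N : ℕ} (hN : d + 1 ≤ N + 1) (x x' : Fin (d + 1) → ℤ)
    (r r' : Fin (d + 1) → Fin n) (μ ν : Fin (d + 1)) :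
    ‖(DeltaA n M 1)⁻¹ (bpt n M (toT M x) r, μ) (bpt n M (toT M x') r', ν)
        - (∑ j ∈ Finset.range N, ((Lap n M + 1)⁻¹) ^ (j + 1)) (bpt n M (toT M x) r, μ) (bpt n M (toT M x') r', ν)‖
      ≤ ((n : ℝ) ^ (d + 1))⁻¹ * (MD183 (d + 1) N * periodConst (kappa183 (d + 1)) d *
          Real.exp (-(kappa183 (d + 1) / (d + 1) * torusSupNorm M (x - x')))) := by
  rw [DeltaA_one_inv_bpt_eq n hn M hN, add_sub_cancel_left, norm_mul, norm_inv, norm_pow, Complex.norm_natCast]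
  exact mul_le_mul_of_nonneg_left (torusKernel_Mcov_decay n hN μ ν r r' (one_le_M M) (x - x')) (by positivity)

include hn in
/-- the same for arbitrary coarse classes `y, y′ ∈ T₁`, through the canonical representatives
`B6LowerBound2153Torus.rep` (`toT ∘ rep = id`). [folklore] -/
theorem norm_DeltaA_one_inv_bpt_sub_free_le' {N : ℕ} (hN : d + 1 ≤ N + 1) (y y' : Tor M)
    (r r' : Fin (d + 1) → Fin n) (μ ν : Fin (d + 1)) :
    ‖(DeltaA n M 1)⁻¹ (bpt n M y r, μ) (bpt n M y' r', ν)
        - (∑ j ∈ Finset.range N, ((Lap n M + 1)⁻¹) ^ (j + 1)) (bpt n M y r, μ) (bpt n M y' r', ν)‖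
      ≤ ((n : ℝ) ^ (d + 1))⁻¹ * (MD183 (d + 1) N * periodConst (kappa183 (d + 1)) d *
          Real.exp (-(kappa183 (d + 1) / (d + 1) *
            torusSupNorm M (B6LowerBound2153Torus.rep M y - B6LowerBound2153Torus.rep M y')))) := by
  have h := norm_DeltaA_one_inv_bpt_sub_free_le n hn M hN (B6LowerBound2153Torus.rep M y)
    (B6LowerBound2153Torus.rep M y') r r' μ ν
  rwa [toT_rep, toT_rep] at h

end Cov

/-! ## §2. The free part = the fine-torus kernel of `freeMult` -/

section FreeSymbol

variable (n : ℕ) [NeZero n] (M : Fin d → ℕ) [hM : ∀ μ, NeZero (M μ)]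

/-- `‖e^{iθ} − 1‖² = 2 − 2cos θ`. [folklore] -/
theorem norm_exp_mul_I_sub_one_sq (θ : ℝ) :
    ‖Complex.exp ((θ : ℂ) * I) - 1‖ ^ 2 = 2 - 2 * Real.cos θ := by
  rw [Complex.sq_norm, Complex.normSq_apply]
  simp only [sub_re, sub_im, one_re, one_im, exp_ofReal_mul_I_re, exp_ofReal_mul_I_im, sub_zero]
  nlinarith [Real.sin_sq_add_cos_sq θ]

/-- the fine-torus character value at a momentum class, in the `sOf` convention:
`ψ_{nM_ν}(p_ν) = e^{i·sOf(p)_ν}`. [folklore] -/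
theorem stdAddChar_eq_exp_sOf (p : Tor (fine n M)) (ν : Fin d) :
    (ZMod.stdAddChar (N := fine n M ν)) (p ν) = Complex.exp (((sOf (fine n M) p ν : ℝ) : ℂ) * I) := by
  conv_lhs => rw [← ZMod.coe_valMinAbs (p ν)]
  rw [ZMod.stdAddChar_coe]
  congr 1
  have hN : ((fine n M ν : ℕ) : ℂ) ≠ 0 := by exact_mod_cast NeZero.ne (fine n M ν)
  simp only [sOf]
  push_cast
  field_simp

/-- **THE TYPED LAPLACIAN SYMBOL IS THE FINE-ZONE SYMBOL**: `Δ(p) = B5Prop11Lower.LapSym n M (p, μ)` (`= Σ_ν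
|n(e^{2πi p_ν/(nM_ν)} − 1)|²`, (1.31)) equals `B5G183FreeDecay.fineSym n (sOf (fine n M) p) = n²Σ_ν(2 − 2cos sOf(p)_ν)`
(any dimension; independent of the component `μ`). [cite: Balaban1984PropagatorsI, (1.31) p.23 (location of the symbol)] [folklore] -/
theorem LapSym_eq_fineSym (p : Tor (fine n M)) (μ : Fin d) :
    ((LapSym n M (p, μ) : ℝ) : ℂ) = fineSym n (ofRealVec (sOf (fine n M) p)) := by
  have hν : ∀ ν, ‖fsym (fine n M) (n : ℂ) ν (p, μ)‖ ^ 2 = (n : ℝ) ^ 2 * (2 - 2 * Real.cos (sOf (fine n M) p ν)) := by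
    intro ν
    unfold fsym
    rw [stdAddChar_eq_exp_sOf, norm_mul, mul_pow, Complex.norm_natCast, norm_exp_mul_I_sub_one_sq]
  unfold LapSym
  simp_rw [hν]
  rw [fineSym_eq]
  push_cast
  refine Finset.sum_congr rfl fun ν _ => ?_
  simp only [ofRealVec]

end FreeSymbol

section Free

variable (n : ℕ) [NeZero n] (M : Fin (d + 1) → ℕ) [hM : ∀ μ, NeZero (M μ)]

/-- the two momentum conventions on the FINE grid give the same value of the free multiplier: for a fine momentum
class `p` with grid coordinates `k = torFin (fine n M) p`,
`R_N(Δ(p)) = freeMult n N (2π rep(k_i/(nM_i)))` (`freeMult` is `2π`-periodic; on the far face `cos(−π) = cos π`).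
[folklore] -/
theorem resolv_LapSym_grid_eq (N : ℕ) (p : Tor (fine n M)) (μ : Fin (d + 1)) :
    resolv N (LapSym n M (p, μ) : ℂ)
      = freeMult n N (ofRealVec (fun i => 2 * Real.pi *
          B4TorusKernel.rep ((((torFin (fine n M) p i : ℕ) : ℝ) / fine n M i : ℝ) : UnitAddCircle))) := by
  unfold freeMult
  rw [LapSym_eq_fineSym, fineSym_eq, fineSym_eq]
  congr 1
  refine Finset.sum_congr rfl fun i _ => ?_
  congr 2
  simp only [ofRealVec]
  rcases two_pi_rep_grid (fine n M) p i with h | ⟨h1, h2⟩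
  · rw [h]
  · rw [h1, h2]
    push_cast
    rw [Complex.cos_neg]

/-- **THE FREE PART IS THE FINE-TORUS KERNEL OF `freeMult`**: on fine lattice representatives `m, m′ ∈ ℤ^{d+1}`,
`[Σ_{j<N}((Lap+1)⁻¹)^{j+1}]_{(m̄,μ),(m̄′,ν)} = δ_{μν} · MultiPeriod.torusKernel (descendC (freeMult n N)) (fine n M) (m − m′)`
— the periodised massive free lattice propagator polynomial (`B5G183KernelSplit.resolventPowers_apply` + the grid
dictionary). [folklore] -/
theorem freePart_toT_eq_torusKernel (N : ℕ) (m m' : Fin (d + 1) → ℤ) (μ ν : Fin (d + 1)) :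
    (∑ j ∈ Finset.range N, ((Lap n M + 1)⁻¹) ^ (j + 1)) (toT (fine n M) m, μ) (toT (fine n M) m', ν)
      = if μ = ν then
          torusKernel (descendC (fun q : Fin (d + 1) → ℂ => freeMult n N q)
            (stripRegular_freeMult n (rOf_div_pos n d).le (rOf_div_admissible n d) N) (rOf_div_pos n d).le)
            (fine n M) (m - m')
        else 0 := by
  rw [resolventPowers_apply]
  by_cases h : μ = ν
  · rw [if_pos h, if_pos h]
    unfold torusKernel torusSum
    rw [card_Tor_cast]
    congr 1
    refine Fintype.sum_equiv (torFin (fine n M)) _ _ fun p => ?_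
    have hsub : chi (fine n M) p (toT (fine n M) m - toT (fine n M) m')
        = chi (fine n M) p (toT (fine n M) m) * conj (chi (fine n M) p (toT (fine n M) m')) := by
      rw [sub_eq_add_neg, chi_add_right, conj_chi, ← chi_neg_neg (fine n M) (-p) (toT (fine n M) m'), neg_neg]
    rw [descendC_apply, B4TorusKernel.MultiPeriod.descend_gridPt, ← chi_toT_eq_mFourier, ← toT_sub,
      hsub, resolv_LapSym_grid_eq n M N p μ]
    ring
  · rw [if_neg h, if_neg h]

/-- decay of the free part on the fine torus, `B5G183FreeDecay.torusKernel_freeMult_decay` BY NAME: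
`‖[Σ_{j<N}((Lap+1)⁻¹)^{j+1}]_{(m̄,μ),(m̄′,ν)}‖ ≤ MF(N) · periodConst(r(d+1)/n, d) · e^{−((r(d+1)/n)/(d+1)) |m − m′|_{T_η,∞}}`.
CAVEAT (HONEST SCOPE (iii)): TRUE AS TYPED, but `periodConst (r(d+1)/n) d` is NOT uniform in `n`. [folklore] -/
theorem norm_freePart_le (N : ℕ) (m m' : Fin (d + 1) → ℤ) (μ ν : Fin (d + 1)) :
    ‖(∑ j ∈ Finset.range N, ((Lap n M + 1)⁻¹) ^ (j + 1)) (toT (fine n M) m, μ) (toT (fine n M) m', ν)‖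
      ≤ MF N * periodConst (rOf (d + 1) / n) d *
          Real.exp (-((rOf (d + 1) / n) / (d + 1) * torusSupNorm (fine n M) (m - m'))) := by
  rw [freePart_toT_eq_torusKernel]
  by_cases h : μ = ν
  · rw [if_pos h]
    exact torusKernel_freeMult_decay n N (one_le_M (fine n M)) (m - m')
  · rw [if_neg h, norm_zero]
    have h1 := MF_nonneg N
    have h2 := (periodConst_pos (rOf_div_pos n d) d).le
    positivity

end Free

/-! ## §3. Assembly: an entrywise exponential majorant for the kernel of `G = Δ_1⁻¹` -/

section Full

variable (n : ℕ) [NeZero n] (hn : 1 ≤ n) (M : Fin (d + 1) → ℕ) [hM : ∀ μ, NeZero (M μ)]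

include hn in
/-- **ENTRYWISE MAJORANT FOR THE KERNEL OF `G = Δ_1⁻¹`** between the block points `n·x̄ + r`, `n·x̄′ + r′`:
free majorant at the fine torus distance `|n(x − x′) + r − r′|_{T_η,∞}` plus covariant majorant at the coarse torus
distance `|x − x′|_{T₁,∞}` (HONEST SCOPE (iii): only the second constant is `n`-uniform in this leaf).
[cite: Balaban1984PropagatorsI, Prop. 1.2 (1.110) p.35 (location; kernel-level `a = 1` companion, constants ours)] [folklore] -/
theorem norm_DeltaA_one_inv_bpt_le {N : ℕ} (hN : d + 1 ≤ N + 1) (x x' : Fin (d + 1) → ℤ)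
    (r r' : Fin (d + 1) → Fin n) (μ ν : Fin (d + 1)) :
    ‖(DeltaA n M 1)⁻¹ (bpt n M (toT M x) r, μ) (bpt n M (toT M x') r', ν)‖
      ≤ MF N * periodConst (rOf (d + 1) / n) d *
          Real.exp (-((rOf (d + 1) / n) / (d + 1) *
            torusSupNorm (fine n M)
              ((fun i => (n : ℤ) * x i + ((r i : ℕ) : ℤ)) - (fun i => (n : ℤ) * x' i + ((r' i : ℕ) : ℤ)))))
        + ((n : ℝ) ^ (d + 1))⁻¹ * (MD183 (d + 1) N * periodConst (kappa183 (d + 1)) d *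
          Real.exp (-(kappa183 (d + 1) / (d + 1) * torusSupNorm M (x - x')))) := by
  have hcov := norm_DeltaA_one_inv_bpt_sub_free_le n hn M hN x x' r r' μ ν
  have hfree := norm_freePart_le n M N (fun i => (n : ℤ) * x i + ((r i : ℕ) : ℤ))
    (fun i => (n : ℤ) * x' i + ((r' i : ℕ) : ℤ)) μ ν
  rw [← bpt_toT, ← bpt_toT] at hfree
  have key : ∀ (G F : ℂ), ‖G‖ ≤ ‖F‖ + ‖G - F‖ := fun G F => by
    calc ‖G‖ = ‖F + (G - F)‖ := by rw [add_sub_cancel]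
      _ ≤ ‖F‖ + ‖G - F‖ := norm_add_le _ _
  exact (key _ _).trans (add_le_add hfree hcov)

end Full

end

end Literature.MathematicalPhysics.QuantumFieldTheory.Balaban1983to89.B5G183KernelDecay
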